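import Mathlib
import HarnessLib
import HarnessLib.Audit
import Summits.BirchSwinnertonDyer.Statement
import Literature.NumberTheory.EllipticCurves.PAdicLFunction
import Literature.NumberTheory.EllipticCurves.IwasawaSelmer
import Literature.NumberTheory.EllipticCurves.GlobalMinimalModelProofs
import Literature.NumberTheory.EllipticCurves.BSDInvariantsProofs
import Literature.NumberTheory.EllipticCurves.CanonicalPAdicHeight
import HarnessLib.Audit.Status.Attr

/-!
Route: PAdicOrder

CLOSED (superseded) 2026-08-16T06:27:11Z by planner-rchoice-BirchSwinnertonDyer-PAdicOrder-7eaad53b-0 — reason: superseded:route-BirchSwinnertonDyer-PAdicOrderV2 — superseded by route-BirchSwinnertonDyer-PAdicOrderV2 — note: route-choice default applied (rchoice 7eaad53b, 2026-08-16): SPLIT/SUPERSEDE. The thesis, the certified deciding theorem closes : PAdicOrderThesisR2 -> BirchSwinnertonDyer and the whole keeper crux grouping (stmt-0487 thesis node, cruxes 0489/0490/0509/0515, support 0491/0140, new glue CruxesToThesi. The file is kept as the record of this route; refuted decls are indexed as negative knowledge (`ledger negatives`).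

For every elliptic curve E/ℚ, written as a globally minimal Weierstrass equation W, there are a good
ORDINARY prime p
and the newform f of E (aₙ(f) = aₙ(W), modularity) such that the Mazur–Swinnerton-Dyer /
Mazur–Tate–Teitelbaum p-adic
L-function L_p(E,T) = L_p(f, α_p, T) ∈ ℚ_p⟦T⟧ (α_p = unitRoot W p; T-normalisation of
SteinWuthrich2013 §3) satisfies BOTH
  ord_{T=0} L_p(E,T) = ord_{s=1} L(E,s)   (p-adic order of vanishing = complex order of vanishing;
crux #2)   and
  ord_{T=0} L_p(E,T) = rank_ℤ E(ℚ)         (rank clause (i) of the Mazur–Tate–Teitelbaum conjecture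
BSD(p); crux #3).
X is the target item `PAdicOrderThesisR2` (X = X₂ ∧ X₃ at one prime: neither conjunct alone reaches
the Statement). It
follows from cruxes #2 ∧ #3 at any one good ordinary p ≥ 5 (tree theorem
`WeierstrassCurve.exists_good_ordinary_prime_holds`)
through modularity, which enters ONLY as the inlined antecedent of the support glue `CruxesToThesis`
(the unfolded body of
the cite-only fact `ModularForms.exists_isNewformOf`, rfl-equal; no route decl names an unproved
constant). The deciding
theorem `closes : PAdicOrderThesisR2 → BirchSwinnertonDyer` is PROVED in the route file (global
minimal model + invariance of
both ranks + Nat.cast injectivity).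
Lean: `∀ (W : WeierstrassCurve ℚ) [W.IsElliptic] [W.IsGloballyMinimal], ∃ (p : ℕ) (_ : Fact
p.Prime), Literature.NumberTheory.EllipticCurves.IsOrdinaryAt W p ∧ ∃ (N : ℕ) (_ : NeZero N) (f :
CuspForm (CongruenceSubgroup.Gamma0 N) 2),
Literature.NumberTheory.EllipticCurves.ModularForms.IsNewformOf W f ∧
(Literature.NumberTheory.EllipticCurves.padicLFunction f
(Literature.NumberTheory.EllipticCurves.unitRoot W p : ℚ_[p])).order = W.analyticRank ∧
(Literature.NumberTheory.EllipticCurves.padicLFunction f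
(Literature.NumberTheory.EllipticCurves.unitRoot W p : ℚ_[p])).order = W.mordellWeilRank`

Rationale: WHY THIS LINE. The route imports p-adic analysis / cyclotomic Iwasawa theory into the
complex-analytic statement: at a good
ordinary prime p the chain rank E(ℚ) ≤ corank Sel_{p^∞}(E/ℚ) ≤ ord_T char_Λ X(E/ℚ_∞) ≤ ord_T
L_p(E,T) is a THEOREM
(Kato2004Asterisque Thm 17.4/18.4 + Mazur control, GreenbergLNM1716 §4), and equality throughout is:
the cyclotomic main
conjecture (SkinnerUrban2014; arXiv:2412.20078 removes the auxiliary hypotheses at good ordinary p >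
3 with irreducible ρ̄)
∧ #Ш(E)[p^∞] < ∞ ∧ semisimplicity of T on X(E/ℚ_∞)⊗ℚ_p at T = 0 (⇔ non-degeneracy of the canonical
cyclotomic p-adic
height: Schneider1985 Thm 2', PerrinRiou1992 §3.3; GreenbergLNM1716 Conj. 1.12). What is NOT known
in any case of analytic
rank ≥ 2 — and only through p-adic Gross–Zagier (PerrinRiou1987, Kobayashi2013) in rank 1 — is that
the p-adic and the
complex orders of vanishing AGREE; MazurTateTeitelbaum1986Invent §II.10 conjecture both equalities
(Delbourgo2008 Conj.
2.3(i)). The line isolates that purely analytic comparison between two L-functions of one motive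
(crux #2), which no other
BSD route states, and needs it at ONE ordinary prime per curve only (thesis is ∃p). Assembly is
bookkeeping and is PROVED:
`closes : PAdicOrderThesisR2 → BirchSwinnertonDyer` passes to a global minimal model C • W
(hasGlobalMinimalModel_rat_holds,
Silverman AEC VIII.8.3) and uses invariance of both ranks under C
(analyticRank/mordellWeilRank_variableChange_holds).
DEPENDENCY HYGIENE (rbadge g4, 2026-08-16). needs-fact:
Literature.NumberTheory.EllipticCurves.ModularForms.exists_isNewformOf
(modularity, BCDT2001 Thm A / DiamondShurman2005 Thm 8.8.3) — the one genuinely needed Literature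
fact: L_p(E,T) is the
p-adic L-function OF THE NEWFORM, so the ∃ f of X is discharged by nothing else; it is tier-0 debt
shared with every BSD
route (WeierstrassCurve.hasEntireLFunction_rat of Statement.lean reduces to it,
hasEntireLFunction_rat_of_exists_isNewformOf).
It no longer blocks staffing: following the refuter route-review (O1, 2026-08-15) the glue
CruxesToThesis (stmt-1058) now
takes the fact's UNFOLDED BODY `(∀ W [IsElliptic] [NeZero (conductorNorm ℤ W)], ∃ f : CuspForm
(Gamma0 (conductorNorm ℤ W)) 2,
IsNewformOf W f)` as antecedent (Iff.rfl with the constant; same 7-line proof, planner folder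
Sketch3.lean rc 0), so the
gate's used-constants cone of items + closes has NO unproved dependency. Module-level ride-alongs
(no item consumes them):
existsUnique_isNewformOf (⇔ exists_isNewformOf, proved iff), selmer_control (IwasawaSelmer.lean,
home of SelmerDualData for
crux #4; Mazur control is load-bearing only for the foreseen split of #3),
rootNumber_eq_algebraicRootNumber +
nonempty_completedLContinuations (RootNumber.lean ⇐ RootNumberProofs ⇐ LFunctionSmulProofs ⇐
BSDInvariantsProofs, imported for
closes' analyticRank_variableChange_holds), exists_isCanonical + exists_isCanonicalK +
HasSplitMultiplicativeReductionAtPrime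
(CanonicalPAdicHeight / PAdicHeights, home of PAdicHeightData.IsCanonical and SchneiderConjecture
for crux #4b 0536 only).
SHED this pass: PAdicBSD.lean (kato_divisibility, kato_finite_of_L_one_ne_zero,
skinner_urban_main_conjecture,
greenberg_stevens) — its only consumer was the premise `IsCyclotomicVariable p γ` of the rank-0 leaf
0525, now removed (see
SUPPORT). Explicit imports: PAdicLFunction, IwasawaSelmer, GlobalMinimalModelProofs,
BSDInvariantsProofs, CanonicalPAdicHeight.
SHAPE DEBT (operator-only, unchanged since 2026-08-15): the byte-identical duplicate assembly
Assembly (stmt-0135) ≡ Assembly2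
(stmt-0488) from the 08-13 probe-bug supersession keeps route.multi-assembly and items-cap (17 > 15)
standing; no planner verb
lowers the assembly count (--drop 'cannot be dropped', --retriage 'cannot be retriaged', --restate
keeps the kind) and every
`route edit` that touches items is bounced on the post-edit projection — five planner generations
confirmed it. It does NOT
block staffing (route-BirchSwinnertonDyer-Squeeze is READY in the same shape). Operator: moot
stmt-0135; then the five
re-purposed r1 slots below may be dropped or kept at will (each is closable today).

RANKED CRUXES. #2 PAdicOrderComparisonR2 (stmt-0489) — at every good ordinary p and for the newform
f of E:
ord_{T=0} L_p(f,α_p,T) = ord_{s=1} L(E,s) (hardest, new: for r_an ≥ 2 only the parity of ord_T is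
known; in rank 1 it is
⇔ h_p(P) ≠ 0 by PerrinRiou1987 Thm 1.3; one (E,p) with degenerate canonical height refutes it as
stated; MTT86 §II.10,
Delbourgo2008 §2.1 'still open'). #3 PAdicOrderPadicBSDrankR2 (stmt-0490) — ord_{T=0} L_p = rank_ℤ
E(ℚ) at every good
ordinary p = MTT BSD(p)(i) verbatim (Delbourgo2008 Conj. 2.3(i)); modulo IMC it is ⇔ Ш[p^∞] finite ∧
T-semisimplicity,
both open in rank ≥ 2 (GreenbergLNM1716 Conj. 1.12–1.13; SkinnerUrban2014 needs p ≥ 3, ρ̄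
irreducible). #4
PAdicOrderSemisimpleR3 (stmt-0509) — HEIGHT-FREE SCHNEIDER: p odd good ordinary, κ cyclotomic with
top generator γ,
D : SelmerDualData: (X⊗ℚ_p)[T²] = (X⊗ℚ_p)[T] (= T-part of Greenberg's complete-reducibility Conj.
1.12; ⇔ Reg_p ≠ 0 when
Ш[p^∞] < ∞, Schneider1985; open for every non-CM curve of rank ≥ 1; BertoliniDarmon: anticyclotomic
heights CAN degenerate).
#4b PAdicOrderSchneiderR8 (stmt-0536) — Schneider's conjecture proper for the canonical cyclotomic
height (Reg_p ≠ 0, p ≥ 5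
good ordinary; twin of #4 under Ш[p^∞] < ∞; its module CanonicalPAdicHeight carries the unproved
construction facts
exists_isCanonical/ -K as ride-alongs — lowest staffing priority; #4 is the form the route uses). #5
PAdicOrderRankOneR4
(stmt-0515) — the analytic-rank-1 case of #2: r_an = 1 ⇒ ord_T L_p(E,T) = 1 ('≥' is interpolation;
'≤' ⇔ h_p(P) ≠ 0 for the
generator via PerrinRiou1987 + GrossZagier/Kolyvagin + a twist; CM case Bertrand1982; open non-CM).
TARGET (rank 0,
auto-crux): PAdicOrderThesisR2 (stmt-0487) = X. SUPPORT (not staffing; † = closable TODAY, one-line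
proofs in planner folder
Sketch3.lean, lean check rc 0): PAdicOrderKatoSideR2 (stmt-0491; rank ≤ ord_T L_p, p odd — KNOWN,
Kato2004Asterisque Thm 18.4
p.281 = fact kato_mordellWeilRank_le_order_padicLFunction, closable once that fact is vendored with
proof);
† PAdicOrderExistsOrdinary (stmt-0140; = tree theorem exists_good_ordinary_prime_holds); †
CruxesToThesis (stmt-1058;
(modularity, unfolded) → #2 → #3 → X); † Assembly2 (stmt-0488) and its duplicate † Assembly
(stmt-0135) (minimal-model facts →
X → BirchSwinnertonDyer; `fun _ _ hX => closes hX`). RE-PURPOSED r1 SLOTS (this pass; until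
2026-08-16 these five decls were
byte-identical duplicates of 0487/0489/0490/0536/0491 — refuters asked for the merge five times,
drops are operator-blocked, so
each slot now carries a DISTINCT closable glue lemma over the route decls; their old `informal` text
is stale, the signature
is the truth): † PAdicOrderThesis (stmt-0134) := BirchSwinnertonDyer → #3 → #2 (KILL CRITERIA (d):
given BSD-rank, MTT(i)
yields the comparison for free — the converse is the bet); † PAdicOrderComparison (stmt-0136) := #2
→ #5 (the rank-one crux
is the literal specialisation of #2: refuting 0515 at (E,p) refutes 0489 there); †
PAdicOrderPadicBSDrank (stmt-0137) :=
#3 → PAdicOrderKatoSideR2 (Kato's inequality is the known lower half of #3); † PAdicOrderKatoSide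
(stmt-0139) :=
PAdicOrderKatoSideR2 → #2 → (r_MW ≤ r_an for every curve with an odd good ordinary prime and a
newform) — Kato + crux #2
give the UB half of BSD (cf. route Squeeze's crux SqueezeUBR2); PAdicOrderSchneider (stmt-0138) :=
the r_an = 0 CASE OF #4 stated outright (p odd good ordinary, r_an = 0 ⇒
(X⊗ℚ_p)[T²] = (X⊗ℚ_p)[T]; the special case grounder-A-0 asked for on 2026-08-13; KNOWN via the
rank-0 leaf 0525 below plus pure
Λ-module algebra (p^k T²)·x = (p^k T)·(T·x) — Sketch5.lean padicOrderSchneiderM_of_noTtorsion —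
hence closable the day 0525 is;
it is also the literal r_an = 0 instance of 0509). NB 0137/0138/0139 spell the statements of
0491/0525 INLINE rather than by decl name:
the gate renders support items in rank order and comments out forward references as 'BLOCKED:
missing decl'.
PAdicOrderRankZeroNoTtorsionR6 (stmt-0525; rank-0 leaf: p odd good ordinary, κ cyclotomic, γ ANY top
generator, r_an = 0
⇒ X(E/ℚ_∞)⊗ℚ_p has no T-torsion) — this pass removed its premise `IsCyclotomicVariable p γ`
(T-torsion at the prime (T) =
(γ−1) is independent of the generator: γ' = γ^u, u ∈ ℤ_p^×, gives γ'−1 = T·unit; this aligns 0525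
with the generality of
#4, whose r_an = 0 case 0138 it implies by two lines of algebra, and sheds PAdicBSD.lean); KNOWN
(interpolation L_p(E,0) =
(1−α⁻¹)²L(E,1)/Ω⁺ ≠ 0 + Kato divisibility char X | L_p in Λ⊗ℚ_p, Kato2004 Thm 17.4, Delbourgo2008
p.41–42) but NOT closable
until kato_divisibility and the interpolation fact isPAdicLFunctionOf_padicLFunction are vendored
with proof (support-level
debt, not load-bearing for X).

KILL CRITERIA. (a) A curve E and a good ordinary p at which ord_{T=0} L_p(E,T) ≠ r_an(E) with both
sides certified
(r_an ≤ 3 is certifiable; ord_T L_p is computable mod p^k by overconvergent modular symbols,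
SteinWuthrich2013 §3) refutes
#2 at that p; if it happens at EVERY good ordinary p ≥ 5 tried for one curve, X is dead → close
refuted:PAdicOrderThesisR2.
(b) A refutation of #4 (one Jordan block of size ≥ 2, equivalently Reg_p = 0 with Ш[p^∞] finite) at
one (E,p) does not kill
X (∃p) but forces the pivot '#3 only at non-degenerate p' and re-ranks #3 below #2. (c) A refutation
of #2/#3/#5 that uses
p ∈ {2,3} only is class MISSTATED (Kato/IMC need p odd resp. p ≥ 3; the thesis needs one p ≥ 5):
repair = the same statement
with `5 ≤ p →`, filed as a new item. (d) Proved elsewhere: BSD-rank via SelmerRank or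
HigherGrossZagier moots the route;
a proof of MTT BSD(p)(i) for all ordinary p (crux #3) plus classical BSD gives #2 for free (support
PAdicOrderThesis records
exactly this implication) — the converse direction is the bet.

NOT DECOMPOSED YET. (i) #3 ⇐ IMC ∧ #4 ∧ corank Ш[p^∞] = 0 (the glued split C₁ → C₂ → C₃ →
PadicBSDrank is foreseen, not
filed; IMC enters as the Literature fact skinner_urban_main_conjecture /
BurungaleCastellaSkinner2024 only when #4 or #3
gets a seat — importing PAdicBSD.lean again would put 4 unproved XL facts back into the module cone;
refuter O3 stands: until
that split is filed a proof of #4 closes nothing upstream). (ii) The leading-term clause (ii) of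
BSD(p), supersingular primes /
± p-adic L-functions (Kobayashi2013) and exceptional-zero primes (greenberg_stevens) — never needed:
the thesis is ∃p and p is
chosen good ordinary. (iii) p = 2, 3 are admitted by the signatures of #2/#3/#5 (harmless for X, see
KILL CRITERIA (c)); a
restriction to 5 ≤ p is a restatement for a tenure pass, not done here to keep the grounder/refuter
stamps. (iv) The five
re-purposed support slots and the duplicate assembly are shape debt, not mathematics: once the
operator moots stmt-0135 a
tenure pass may drop them (items 17 → 11) without touching any crux or the deciding theorem.

CHEAPEST FALSIFIER. Take the rank-2 curve 389a1 and its smallest good ordinary primes p ≥ 5 (p = 5,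
7): compute
ord_{T=0} L_p(E,T) to precision O(p^k, T^6) with overconvergent modular symbols (SteinWuthrich2013
§3, implemented in
Sage/Magma; MazurSteinTate2006 for Reg_p). r_an(389a1) = 2 is certified; the line predicts ord_T = 2
exactly and Reg_p ≠ 0.
ord_T ≥ 3 at both primes (or Reg_p = 0) kills #2 at those p and makes X implausible;
SteinWuthrich2013 §§8–9 report no
such anomaly in their tables (upper bound ord_T L_p = rank verified curve by curve), and
refuter-pool-3's Sage sweep (1047
(E,p) pairs incl. all 243 rank-2 classes N < 3000, p ≥ 5: 0 anomalies) plus the route-review PARI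
job j003560 (p = 3) found
none, which is why the line is still alive. Not re-run here (hub is compute-free for planners in
repair mode).

Novelty: NOVELTY (retriage pass 2026-08-14; searched BEFORE writing: `lit search --hybrid "order of vanishing
p-adic L-function equals analytic rank … Mazur Tate Teitelbaum"`, `lit frontier BirchSwinnertonDyer
--since 2020`, `lit bridges BirchSwinnertonDyer --cross any`, `lit read` of Delbourgo2008 p.42,
GreenbergLNM1716 pp.64–65 and p.110 (held as book:coatesnd-arithmetic-theory-elliptic-curves),
arXiv:2412.20078 pp.2–4, arXiv:1811.08216 p.3).
Nearest prior art: (1) MazurTateTeitelbaum1986Invent §II.10 = Delbourgo2008 Conj. 2.3(i)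
"order_{s=1} L_p(E,s) = rank_Z E(Q)" in the non-exceptional case — crux PAdicOrderPadicBSDrankR2
verbatim; (2) GreenbergLNM1716 §§1,4,5 (Conj. 1.12–1.13 p.65; Schneider's rank-one result and
Perrin-Riou's p-adic Gross–Zagier p.110): the decomposition IMC ∧ Schneider-semisimplicity ∧
Ш[p^∞]-finite behind the rank clause, and the rank-one comparison via PerrinRiou1987 Thm 1.3 (crux
PAdicOrderRankOneR4); (3) SteinWuthrich2013 §§3,8: ord_T L_p(E,T) as a computable upper bound for
rank E(Q) with Reg_p ≠ 0 verified curve by curve — the same squeeze used instance-wise; (4) the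
inputs Kato2004Asterisque Thm 17.4/18.4, SkinnerUrban2014, and arXiv:2412.20078 (rational cyclotomic
IMC at good ordinary p > 3 with irreducible residual representation, auxiliary-prime hypothesis
removed).
Delta: no new mechanism — the thesis recombines the printed conjectures. What the route adds is (a)
the ISOLATION of the purely analytic comparison ord_{T=0} L_p(E,T) = ord_{s=1} L(E,s) (  [refs: 2412.20078, 1811.08216, book:coatesnd-arithmetic-theory-elliptic-curves, Delbourgo2008, PerrinRiou1987, SteinWuthrich2013, SkinnerUrban2014, Kobayashi2013]

Barriers (technique_class: iwasawa-main-conjecture p-adic-l-functions p-adic-heights): technique_class: iwasawa-main-conjecture p-adic-l-functions p-adic-heights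
- Literature.Barriers.BirchSwinnertonDyer.PAdicHeightBarrier: NOT evaded — it is the route's
declared bet. In analytic rank one the comparison (PAdicOrderRankOneR4, hence
PAdicOrderComparisonR2) is EQUIVALENT to ⟨P,P⟩_p ≠ 0 (PerrinRiou1987 Thm 1.3;
padicOrderEK_eq_analyticRankEK_iff_height_ne_zero), and the rank clause PAdicOrderPadicBSDrankR2
needs ord_T f_E = corank Sel_{p^∞}, i.e. Schneider non-degeneracy / semisimplicity at T
(Literature.Barriers.BirchSwinnertonDyer.Schneider1985_charGenerator_rankOne; GreenbergLNM1716 Conj.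
1.12). The route files exactly these as cruxes (PAdicOrderSchneiderR8 = Schneider proper,
PAdicOrderSemisimpleR3 = height-free T-semisimplicity) instead of assuming them; the only evasions
it can use are the known ones: Kato's height-free inequality (support PAdicOrderKatoSideR2 = fact
kato_mordellWeilRank_le_order_padicLFunction), the CM rank-one case (Bertrand1982), and
curve-by-curve certification of Reg_p ≠ 0 (MazurSteinTate2006 §1, SteinWuthrich2013 §4) — the latter
is also the refutation channel for one (E,p).
- Literature.Barriers.BirchSwinnertonDyer.ExceptionalZeroBarrier: evaded by hypothesis — every item
carries good ORDINARY reduction (Literature.NumberTheory.EllipticCurves.IsOrdinaryAt, resp.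
HasGoodReductionAtPrime ∧ p ∤ a_p), where the multiplier (1 − α⁻¹)² ≠ 0 (|α| = √p); split
multiplicative p is never used, and since the thesis is ∃p the in-tree theorem Weierst

History (route lifecycle, newest last):
- 2026-08-16T03:45:04Z · AUTO-CRUX (edit): PAdicOrderThesisR2 — hypotheses of the deciding theorem that nothing in the route derives are cruxes (planner-rchoice-BirchSwinnertonDyer-PAdicOrder-4675e707-g2-0)
- 2026-08-16T06:27:11Z · CLOSED superseded — superseded:route-BirchSwinnertonDyer-PAdicOrderV2 (planner-rchoice-BirchSwinnertonDyer-PAdicOrder-7eaad53b-0)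

sub-problem: BirchSwinnertonDyer · status: closed(superseded) · opened planner-BirchSwinnertonDyer-Survey-0 2026-08-13T06:05:31Z · rev 14 · ledger route-BirchSwinnertonDyer-PAdicOrder
GENERATED by the gate from the ledger (D-0016/17). Provers cite these decls: `theorem foo : Summit.BirchSwinnertonDyer.BirchSwinnertonDyer.Theses.PAdicOrder.<Decl> := …` in Summits/BirchSwinnertonDyer/BirchSwinnertonDyer/Theorems/<Name>.lean.
-/

namespace Summit.BirchSwinnertonDyer.BirchSwinnertonDyer.Theses.PAdicOrder

open scoped BigOperators Topology Manifold Classical MeasureTheory ProbabilityTheory Matrix InnerProductSpace ComplexConjugate ContinuousMap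
open Filter Set Function TopologicalSpace MeasureTheory

attribute [summit_statement] _root_.BirchSwinnertonDyer

open Literature

/-- item stmt-BirchSwinnertonDyer-0487 · crux (kind.auto-crux: conjecture-grade) · rank 0 · open · by planner
why it might fail: X = (0489 ∧ 0490) at ONE good ordinary p per curve: false if some rank ≥ 2 curve has a degenerate canonical p-adic height or infinite Ш[p^∞] at EVERY good ordinary p — nothing in print excludes this; as typed, ∃p ∃f need exists_good_ordinary_prime_holds + a (sorried) newform-existence fact.
sources: MazurTateTeitelbaum1986Invent, §II.10, Delbourgo2008, p.42 Conj. 2.3(i), MazurSteinTate2006, Conj. 1.1, Literature.Barriers.BirchSwinnertonDyer.PAdicHeightBarrier (Literature.Barriers.BirchSwinnertonDyer.PAdicHeightBarrier), Literature.Barriers.BirchSwinnertonDyer.SelmerRankBarrier (Literature.Barriers.BirchSwinnertonDyer.SelmerRankBarrier), WeierstrassCurve.exists_good_ordinary_prime_holds (OrdinaryPrimesProofs.lean:290); Literature.NumberTheory.EllipticCurves.ModularForms.existsUnique_isNewformOf (sorried, CuspFormLFunction.lean)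
SUPERSEDES stmt-BirchSwinnertonDyer-0134 (r2). The old item was FALSELY closed 2026-08-13T06:58:11Z
by the gate decides-probe of p2749 as 'proved' by
Literature.EllArith.HigherGrossZagierDatum.leadingLCoeff_eq / det_ne_zero_of_leadingLCoeff_ne_zero —
lemmas taking (D : HigherGrossZagierDatum W W.analyticRank) as hypothesis, which cannot inhabit this
Prop (the same probe 'proved' both old 0145 and its negation-side 0257). Statement, rank and route
unchanged; grounder/refuter notes on stmt-BirchSwinnertonDyer-0134 remain valid and should be
copied, not redone. Thesis X of route PAdicOrder: for every elliptic E/ℚ (globally minimal W) there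
are a good ordinary prime p and the newform f of E with PowerSeries.order of the
Mazur–Swinnerton-Dyer p-adic L-function Literature.NumberTheory.EllipticCurves.padicLFunction f
(unitRoot W p) equal to both analyticRank and mordellWeilRank. MazurTateTeitelbaum1986 §II.10;
SteinWuthrich2013 §3 (T-normalisation). imports: Summits.BirchSwinnertonDyer.Statement,
Literature.NumberTheory.EllipticCurves.PAdicBSD (routes/SketchPAdic.lean). NOT elaborated at filing
time: DiophantineGeometry/Conductor.olean missing from the shared build (import fails before th -/
@[route_item "route-BirchSwinnertonDyer-PAdicOrder"]
def PAdicOrderThesisR2 : Prop :=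
  ∀ (W : WeierstrassCurve ℚ) [W.IsElliptic] [W.IsGloballyMinimal], ∃ (p : ℕ) (_ : Fact p.Prime), Literature.NumberTheory.EllipticCurves.IsOrdinaryAt W p ∧ ∃ (N : ℕ) (_ : NeZero N) (f : CuspForm (CongruenceSubgroup.Gamma0 N) 2), Literature.NumberTheory.EllipticCurves.ModularForms.IsNewformOf W f ∧ (Literature.NumberTheory.EllipticCurves.padicLFunction f (Literature.NumberTheory.EllipticCurves.unitRoot W p : ℚ_[p])).order = W.analyticRank ∧ (Literature.NumberTheory.EllipticCurves.padicLFunction f (Literature.NumberTheory.EllipticCurves.unitRoot W p : ℚ_[p])).order = W.mordellWeilRank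

/-- item stmt-BirchSwinnertonDyer-0489 · crux · rank 2 · open · by planner
why it might fail: ∀ good ordinary p (X needs one; p = 2,3 included): at any (E,p) with degenerate canonical p-adic height, Kato + Schneider/Perrin-Riou give ord_T L_p ≥ ord_T f_E > corank Sel ≥ r_an (granting BSD-rank): one pair refutes; for r_an ≥ 2 only ord_T L_p ≡ r_an (mod 2) known; no p-adic GZ beyond order 1.
sources: MazurTateTeitelbaum1986Invent, §II.10, Delbourgo2008, p.42 Conj. 2.3(i) and §2.1 ('still an open question'), PerrinRiou1987, Thm 1.3 (Literature.NumberTheory.EllipticCurves.perrinRiou_padicGrossZagier, PAdicGrossZagier.lean:88), Schneider1985, Thm 2' (as printed GreenbergLNM1716 §4 p.110: h_p(P) = 0 ⇒ T² ∣ f_E), arXiv:1609.02528, p.5 (Disegni 2020: 'order of vanishing is r̃ iff the extended height pairing is non-degenerate'; rank ≤ 1 results are I^r-membership + leading term, not ord = r), Literature.Barriers.BirchSwinnertonDyer.PAdicHeightBarrier (Literature.Barriers.BirchSwinnertonDyer.PAdicHeightBarrier)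
SUPERSEDES stmt-BirchSwinnertonDyer-0136 (r2). The old item was FALSELY closed 2026-08-13T06:58:11Z
by the gate decides-probe of p2749 as 'proved' by
Literature.EllArith.HigherGrossZagierDatum.leadingLCoeff_eq / det_ne_zero_of_leadingLCoeff_ne_zero —
lemmas taking (D : HigherGrossZagierDatum W W.analyticRank) as hypothesis, which cannot inhabit this
Prop (the same probe 'proved' both old 0145 and its negation-side 0257). Statement, rank and route
unchanged; grounder/refuter notes on stmt-BirchSwinnertonDyer-0136 remain valid and should be
copied, not redone. p-adic order of vanishing equals complex order of vanishing (both conjecturally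
= rank; MazurTateTeitelbaum1986 §II.10). Known: r_an = 0 ⇔ ord_T = 0 (interpolation L_p(0) =
(1-1/α)² L(E,1)/Ω⁺, α ≠ 1 by Hasse); r_an = 1 ⇒ ord_T ≥ 1, with equality iff the p-adic height of
the Heegner point is nonzero (PerrinRiou1987 p-adic Gross–Zagier; Kobayashi2013 supersingular
analogue). Open in every case with r_an ≥ 2 or ord_T ≥ 2. The deep new crux of this route. imports:
Summits.BirchSwinnertonDyer.Statement, Literature.NumberTheory.EllipticCurves.PAdicBSD
(routes/SketchPAdic.lean). NOT elaborated at filing time: DiophantineGeometry/Condu -/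
@[route_item "route-BirchSwinnertonDyer-PAdicOrder", crux]
def PAdicOrderComparisonR2 : Prop :=
  ∀ (W : WeierstrassCurve ℚ) [W.IsElliptic] [W.IsGloballyMinimal] (p : ℕ) [Fact p.Prime], Literature.NumberTheory.EllipticCurves.IsOrdinaryAt W p → ∀ {N : ℕ} [NeZero N] (f : CuspForm (CongruenceSubgroup.Gamma0 N) 2), Literature.NumberTheory.EllipticCurves.ModularForms.IsNewformOf W f → (Literature.NumberTheory.EllipticCurves.padicLFunction f (Literature.NumberTheory.EllipticCurves.unitRoot W p : ℚ_[p])).order = W.analyticRank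

/-- item stmt-BirchSwinnertonDyer-0490 · crux · rank 3 · open · by planner
why it might fail: = MTT BSD(p)(i) at EVERY good ordinary p (p = 2 too: no Kato/IMC there): modulo IMC it is ⇔ Ш(E)[p^∞] finite ∧ T-semisimplicity / non-degenerate canonical height at p (Schneider1985; GreenbergLNM1716 Conj 1.12–1.13); either can fail at one (E,p), both open in rank ≥ 2; IMC needs ρ̄ irreducible.
sources: Delbourgo2008, p.42 Conj. 2.3(i) (verbatim) and 'both conjectures rely on the finiteness of Ш[p^∞]', GreenbergLNM1716, §1 Conj. 1.12–1.13 pp.64–65 (book:coatesnd-arithmetic-theory-elliptic-curves), Schneider1985; Literature.Barriers.BirchSwinnertonDyer.Schneider1985_charGenerator_rankOne (PAdicHeightNondegeneracy.lean:207), SkinnerUrban2014 (Literature.NumberTheory.EllipticCurves.skinner_urban_main_conjecture: p ≥ 3, ρ̄ irreducible, auxiliary ℓ); arXiv:2412.20078, Thm 1.6–1.7, Literature.Barriers.BirchSwinnertonDyer.SelmerRankBarrier (Literature.Barriers.BirchSwinnertonDyer.SelmerRankBarrier, SelmerVersusMordellWeil.lean:84), Literature.Barriers.BirchSwinnertonD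yer.PAdicHeightBarrier
SUPERSEDES stmt-BirchSwinnertonDyer-0137 (r2). The old item was FALSELY closed 2026-08-13T06:58:11Z
by the gate decides-probe of p2749 as 'proved' by
Literature.EllArith.HigherGrossZagierDatum.leadingLCoeff_eq / det_ne_zero_of_leadingLCoeff_ne_zero —
lemmas taking (D : HigherGrossZagierDatum W W.analyticRank) as hypothesis, which cannot inhabit this
Prop (the same probe 'proved' both old 0145 and its negation-side 0257). Statement, rank and route
unchanged; grounder/refuter notes on stmt-BirchSwinnertonDyer-0137 remain valid and should be
copied, not redone. Rank clause (i) of the p-adic BSD conjecture (= clause (i) of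
Literature.NumberTheory.EllipticCurves.PAdicBSDConjecture; MazurTateTeitelbaum1986 §II.10). Via IMC
(SkinnerUrban2014 Thm 1 = Literature.NumberTheory.EllipticCurves.skinner_urban_main_conjecture)
ord_T L_p = ord_T char_Λ X(E/ℚ_∞), and ord_T char X = corank Sel_{p^∞} iff the canonical p-adic
height is non-degenerate (Schneider1985; PerrinRiou1992), = rank iff moreover Ш[p^∞] finite. Later
decomposition: IMC ∧ #4 ∧ SelmerRank#5. imports: Summits.BirchSwinnertonDyer.Statement,
Literature.NumberTheory.EllipticCurves.PAdicBSD (routes/SketchPAdic.lean). NOT elaborated at f -/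
@[route_item "route-BirchSwinnertonDyer-PAdicOrder"]
def PAdicOrderPadicBSDrankR2 : Prop :=
  ∀ (W : WeierstrassCurve ℚ) [W.IsElliptic] [W.IsGloballyMinimal] (p : ℕ) [Fact p.Prime], Literature.NumberTheory.EllipticCurves.IsOrdinaryAt W p → ∀ {N : ℕ} [NeZero N] (f : CuspForm (CongruenceSubgroup.Gamma0 N) 2), Literature.NumberTheory.EllipticCurves.ModularForms.IsNewformOf W f → (Literature.NumberTheory.EllipticCurves.padicLFunction f (Literature.NumberTheory.EllipticCurves.unitRoot W p : ℚ_[p])).order = W.mordellWeilRank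

/-- item stmt-BirchSwinnertonDyer-0509 · crux · rank 4 · open · by planner
why it might fail: = T-part of Greenberg's Conj 1.12 (complete reducibility of X(E/ℚ_∞)⊗ℚ_p), open for every non-CM curve of rank ≥ 1: one Jordan block of T of size ≥ 2 at one odd good ordinary p (p = 3, anomalous p allowed) — ⇔ degenerate canonical height when Ш[p^∞] < ∞ — refutes it; evidence is numerical only.
sources: GreenbergLNM1716, §1 Conj. 1.12 pp.64–65 (book:coatesnd-arithmetic-theory-elliptic-curves), Schneider1985, Thm 2'; PerrinRiou1992, §3.3 (cite item wi-04085), MazurSteinTate2006, Conj. 1.1 and Remark 1.2, arXiv:2001.00045, §1.5.2 p.10 (Disegni 2022: 'conjectured … non-degenerate. Results in this direction have been quite rare'; only generic Thm nv CM / nv exc), Literature.Barriers.BirchSwinnertonDyer.AnticyclotomicHeightDegeneracy (Literature.Barriers.BirchSwinnertonDyer.AnticyclotomicHeightDegeneracy; BertoliniDarmon1995 §3.1: p-adic heights CAN degenerate), Literature.Barriers.BirchSwinnertonDyer.PAdicHeightBarrier; Literature.Barriers.BirchSwinnertonDyer.Schneider1985_charGenerator_rankOne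
r3 PIVOT of PAdicOrder crux #4 (SUPERSEDES the informal-only stmt-BirchSwinnertonDyer-0138 as the
route's rank-4 crux; 0138 stays open as the height-side phrasing, blocked on
defn-cyclotomicPAdicHeight which literature-prover-litprove-A-0 settled BLOCKED 2026-08-13T06:25Z:
no formal-group log / p-adic sigma function / p-adic E2 in Mathlib+tree). HEIGHT-FREE SCHNEIDER: for
E/ℚ elliptic (globally minimal W), p odd of good ordinary reduction, ℚ_∞/ℚ the cyclotomic
ℤ_p-extension with topological generator γ, and X = X(E/ℚ_∞) the Pontryagin dual of Sel_{p^∞}(E/ℚ_∞)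
(any D : SelmerDualData, T = γ−1): T acts SEMISIMPLY at T = 0 on X ⊗ ℚ_p, i.e. (X ⊗ ℚ_p)[T²] = (X ⊗
ℚ_p)[T]; spelled without ⊗: if p^k·T²·x = 0 for some k then p^k'·T·x = 0 for some k'. WHY
EQUIVALENT: X ⊗ ℚ_p is a f.g. torsion ℚ_p⟦T⟧-module (Kato, in tree: kato_divisibility.1), ≅ ⊕
ℚ_p⟦T⟧/(f_i); ord_T char_Λ X = Σ ord_T f_i = dim (X⊗ℚ_p)[T^∞], while rank_{ℤ_p} X/TX = #{i : T ∣
f_i} = dim (X⊗ℚ_p)[T] = corank Sel_{p^∞}(E/ℚ) by Mazur control (fact selmer_control,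
IwasawaSelmer.lean; Greenberg1999 Thm 1.2). So the item ⇔ ord_T char X = corank_{ℤ_p}
Sel_{p^∞}(E/ℚ), which by Schneider1985 Thm 2' / PerrinRiou1992 §3.3 is ⇔ non-degen -/
@[route_item "route-BirchSwinnertonDyer-PAdicOrder", crux]
def PAdicOrderSemisimpleR3 : Prop :=
  ∀ (W : WeierstrassCurve ℚ) [W.IsElliptic] [W.IsGloballyMinimal] (p : ℕ) [Fact p.Prime], p ≠ 2 → W.HasGoodReductionAtPrime p → ¬ (p : ℤ) ∣ W.frobeniusTrace p → ∀ (κ : Literature.NumberTheory.EllipticCurves.ZpExtension ℚ p) (γ : Field.absoluteGaloisGroup ℚ), κ.IsCyclotomic → κ.IsTopGenerator γ → ∀ (D : W.SelmerDualData κ γ) (x : D.X), (∃ k : ℕ, (PowerSeries.C ((p : ℤ_[p]) ^ k) * PowerSeries.X ^ 2 : Literature.NumberTheory.EllipticCurves.IwasawaAlgebra p) • x = 0) → ∃ k : ℕ, (PowerSeries.C ((p : ℤ_[p]) ^ k) * PowerSeries.X : Literature.NumberTheory.EllipticCurves.IwasawaAlgebra p) • x = 0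

/-- item stmt-BirchSwinnertonDyer-0536 · crux · rank 4 · closed · moot by None · by planner
why it might fail: Schneider's conjecture proper (Reg_p ≠ 0, canonical cyclotomic height, p ≥ 5 good ordinary): ℚ_p-valued forms lack positivity, a rank ≥ 2 Gram det can vanish; known only in rank 0, CM rank 1 (Bertrand1982), generically in families; one (E,p) with Reg_p = 0 (a finite p-adic computation) refutes.
sources: MazurSteinTate2006, Conj. 1.1 p.4 ('cyclotomic height pairing is nondegenerate; equivalently the p-adic regulator is nonzero'), Delbourgo2008, §2.1 p.42 ('still an open question'), Schneider1982, §1; Schneider1985, Bertrand1982 (CM, rank 1, p-adic transcendence), arXiv:1803.09268, §1 (Burungale–Disegni: not known in any case of rank > 1); arXiv:2001.00045, §1.5.2 p.10 (generic results Thm nv CM / nv exc only), WeierstrassCurve.SchneiderConjecture (PAdicHeights.lean); WeierstrassCurve.exists_isCanonical, isCanonical_unique (CanonicalPAdicHeight.lean); schneiderConjecture_cyclotomicPAdicHeight_iff_of_facts (CyclotomicPAdicHeight.lean:194)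
r8 (session 96): TYPED SUPERSESSION of crux #4b stmt-BirchSwinnertonDyer-0138 (informal-only since
r1: 'Schneider non-degeneracy of the canonical p-adic height', needs_definition
cyclotomicPAdicHeight → BLOCKED → replaced by predicate request defn-IsCanonicalPAdicHeight, DONE
07:52:00Z, p3092 CanonicalPAdicHeight.lean: `WeierstrassCurve.PAdicHeightData.IsCanonical D` in the
SteinWuthrich2013 §4.1 (4.1) normalisation ĥ_p = 2 log_p(e/σ_p) = −2p·(MST h_p), with
isCanonical_unique and named facts exists_isCanonical / exists_admissible_nsmul). STATEMENT =
SCHNEIDER'S CONJECTURE PROPER: E/ℚ elliptic (globally minimal W), p a prime of good ordinary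
reduction, D the canonical cyclotomic p-adic height datum ⇒ Reg_p(E, D) ≠ 0
(WeierstrassCurve.SchneiderConjecture D := padicRegulator D ≠ 0, PAdicHeights.lean:287;
padicRegulator = Gram det on a Mordell–Weil basis, junk 0 only if no basis exists, excluded by
exists_isMordellWeilBasis). Quantifying ∀ D, D.IsCanonical → … is NOT vacuous under the ordinarity
premise (fact exists_isCanonical, same premises p ≥ 5 + good ordinary) and pins D.pairing uniquely
(isCanonical_unique, given fact exists_admissible_nsmul), so this is exactly Schneider1982 §1 -/
@[route_item "route-BirchSwinnertonDyer-PAdicOrder"]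
def PAdicOrderSchneiderR8 : Prop :=
  ∀ (W : WeierstrassCurve ℚ) [W.IsElliptic] [W.IsGloballyMinimal] (p : ℕ) [Fact p.Prime], 5 ≤ p → W.HasGoodReductionAtPrime p → ¬ (p : ℤ) ∣ W.frobeniusTrace p → ∀ D : WeierstrassCurve.PAdicHeightData W p, D.IsCanonical → WeierstrassCurve.SchneiderConjecture D

/-- item stmt-BirchSwinnertonDyer-0515 · crux · rank 5 · open · by planner
why it might fail: '≥ 1' is interpolation; '≤ 1' ⇔ (PerrinRiou1987 p-adic GZ + GZK + twist) h_p(P) ≠ 0 for the generator = rank-1 Schneider, open for non-CM E (CM: Bertrand1982); Disegni 2020's rank ≤ 1 p-adic BSD is I^r-membership + leading term, not ord = 1; one ordinary p with h_p(P) = 0 refutes; p = 2 included.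
sources: PerrinRiou1987, Thm 1.3 (Literature.NumberTheory.EllipticCurves.perrinRiou_padicGrossZagier; cite item wi-04074), Literature.Barriers.BirchSwinnertonDyer.padicOrderEK_eq_analyticRankEK_iff_height_ne_zero (PAdicHeightNondegeneracy.lean:108; Literature.Barriers.BirchSwinnertonDyer.PAdicHeightBarrier), GreenbergLNM1716, §4 p.110 ('Conjecturally h_p(P) ≠ 0 … if h_p(P) = 0 … T² | f_E'), Bertrand1982 (CM case), arXiv:1609.02528, pp.2,5 (Disegni 2020: rank ≤ 1 'full proof' of the I^r̃-form; 'order … is r̃ iff … non-degenerate'), arXiv:1811.08216, §1; Kobayashi2013 (supersingular analogues; no ordinary-prime rescue)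
r4 (session 66): ANALYTIC-RANK-1 CASE of crux #2 (stmt-BirchSwinnertonDyer-0489), filed as its own
rank-5 crux in reaction to fact wi-03670 (p-adic Gross–Zagier) settling BLOCKED
(literature-prover-litprove-A-1: PerrinRiou1987 Thm 1.1 is about L_p(E/K) and the p-adic height over
K, neither in Literature; the ℚ-consequence is a corollary of PR87 + GrossZagier1986 + Kolyvagin1990
+ a twist non-vanishing (BumpFriedbergHoffstein1990/MurtyMurty1991), so per faithfulness a CRUX not
a fact). STATEMENT: E/ℚ elliptic (globally minimal W), p a prime of good ordinary reduction, f the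
newform of E, L_p(E,T) = L_p(f, α_p, T) (MazurTateTeitelbaum1986 §I.13): if ord_{s=1} L(E,s) = 1
then ord_{T=0} L_p(E,T) = 1. LITERAL SPECIALISATION of #2 (same binders, r_an := 1), so refuting it
at one (E,p) refutes #2 at that p (but NOT thesis X, which is ∃p). WHAT IS KNOWN: '≥ 1' is in print
(interpolation L_p(E,0) = (1−α⁻¹)² L(E,1)/Ω = 0, mazur_swinnertonDyer_interpolation
PAdicBSD.lean:236; or Kato: ord_T L_p ≥ corank Sel = 1). '≤ 1' ⇔ L_p'(E,0) ≠ 0 ⇔ (PR87 Thm 1.1 over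
a Heegner field K with p split and L(E^D,1) ≠ 0, dividing by the unit L_p(E^D,0)) h_p(P_K) ≠ 0 ⇔
h_p(P) ≠ 0 for a generator P of E(ℚ)/tors -/
@[route_item "route-BirchSwinnertonDyer-PAdicOrder"]
def PAdicOrderRankOneR4 : Prop :=
  ∀ (W : WeierstrassCurve ℚ) [W.IsElliptic] [W.IsGloballyMinimal] (p : ℕ) [Fact p.Prime], Literature.NumberTheory.EllipticCurves.IsOrdinaryAt W p → W.analyticRank = 1 → ∀ {N : ℕ} [NeZero N] (f : CuspForm (CongruenceSubgroup.Gamma0 N) 2), Literature.NumberTheory.EllipticCurves.ModularForms.IsNewformOf W f → (Literature.NumberTheory.EllipticCurves.padicLFunction f (Literature.NumberTheory.EllipticCurves.unitRoot W p : ℚ_[p])).order = 1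

/-- item stmt-BirchSwinnertonDyer-0134 · support · rank 0 · closed · moot by None · by planner
Thesis X of route PAdicOrder: for every elliptic E/ℚ (globally minimal W) there are a good ordinary
prime p and the newform f of E with PowerSeries.order of the Mazur–Swinnerton-Dyer p-adic L-function
Literature.NumberTheory.EllipticCurves.padicLFunction f (unitRoot W p) equal to both analyticRank
and mordellWeilRank. MazurTateTeitelbaum1986 §II.10; SteinWuthrich2013 §3 (T-normalisation).
imports: Summits.BirchSwinnertonDyer.Statement, Literature.NumberTheory.EllipticCurves.PAdicBSD
(routes/SketchPAdic.lean). NOT elaborated at filing time: DiophantineGeometry/Conductor.olean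
missing from the shared build (import fails before the term is read); every constant checked against
source. Refuter: re-check after rebuild. -/
@[route_item "route-BirchSwinnertonDyer-PAdicOrder"]
def PAdicOrderThesis : Prop :=
  BirchSwinnertonDyer → Summit.BirchSwinnertonDyer.BirchSwinnertonDyer.Theses.PAdicOrder.PAdicOrderPadicBSDrankR2 → Summit.BirchSwinnertonDyer.BirchSwinnertonDyer.Theses.PAdicOrder.PAdicOrderComparisonR2

/-- item stmt-BirchSwinnertonDyer-0136 · support · rank 2 · closed · moot by None · by planner
p-adic order of vanishing equals complex order of vanishing (both conjecturally = rank;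
MazurTateTeitelbaum1986 §II.10). Known: r_an = 0 ⇔ ord_T = 0 (interpolation L_p(0) = (1-1/α)²
L(E,1)/Ω⁺, α ≠ 1 by Hasse); r_an = 1 ⇒ ord_T ≥ 1, with equality iff the p-adic height of the Heegner
point is nonzero (PerrinRiou1987 p-adic Gross–Zagier; Kobayashi2013 supersingular analogue). Open in
every case with r_an ≥ 2 or ord_T ≥ 2. The deep new crux of this route. imports:
Summits.BirchSwinnertonDyer.Statement, Literature.NumberTheory.EllipticCurves.PAdicBSD
(routes/SketchPAdic.lean). NOT elaborated at filing time: DiophantineGeometry/Conductor.olean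
missing from the shared build (import fails before the term is read); every constant checked against
source. Refuter: re-check after rebuild. -/
@[route_item "route-BirchSwinnertonDyer-PAdicOrder"]
def PAdicOrderComparison : Prop :=
  Summit.BirchSwinnertonDyer.BirchSwinnertonDyer.Theses.PAdicOrder.PAdicOrderComparisonR2 → Summit.BirchSwinnertonDyer.BirchSwinnertonDyer.Theses.PAdicOrder.PAdicOrderRankOneR4

-- TODO item stmt-BirchSwinnertonDyer-0137 · support · rank 3 · closed · moot by None · by planner — BLOCKED: missing decl(s) Summit.BirchSwinnertonDyer.BirchSwinnertonDyer.Theses.PAdicOrder.PAdicOrderKatoSideR2; restate via `ledger route edit` once they land: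
--   def PAdicOrderPadicBSDrank : Prop := Summit.BirchSwinnertonDyer.BirchSwinnertonDyer.Theses.PAdicOrder.PAdicOrderPadicBSDrankR2 → ∀ (W : WeierstrassCurve ℚ) [W.IsElliptic] [W.IsGloballyMinimal] (p : ℕ) [Fact p.Prime], p ≠ 2 → Literature.NumberTheory.EllipticCurves.IsOrdinaryAt W p → ∀ {N : ℕ} [NeZero N] (f : CuspForm (CongruenceSubgroup

-- TODO item stmt-BirchSwinnertonDyer-0138 · support · rank 4 · closed · moot by None · by planner — BLOCKED: missing decl(s) Summit.BirchSwinnertonDyer.BirchSwinnertonDyer.Theses.PAdicOrder.PAdicOrderRankZeroNoTtorsionR6; restate via `ledger route edit` once they land: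
--   def PAdicOrderSchneider : Prop := ∀ (W : WeierstrassCurve ℚ) [W.IsElliptic] [W.IsGloballyMinimal] (p : ℕ) [Fact p.Prime], p ≠ 2 → W.HasGoodReductionAtPrime p → ¬ (p : ℤ) ∣ W.frobeniusTrace p → W.analyticRank = 0 → ∀ (κ : Literature.NumberTheory.EllipticCurves.ZpExtension ℚ p) (γ : Field.absoluteGaloisGroup ℚ), κ.IsCyclotomic → κ.IsT

-- TODO item stmt-BirchSwinnertonDyer-0139 · support · rank 5 · closed · moot by None · by planner — BLOCKED: missing decl(s) Summit.BirchSwinnertonDyer.BirchSwinnertonDyer.Theses.PAdicOrder.PAdicOrderKatoSideR2; restate via `ledger route edit` once they land: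
--   def PAdicOrderKatoSide : Prop := (∀ (W : WeierstrassCurve ℚ) [W.IsElliptic] [W.IsGloballyMinimal] (p : ℕ) [Fact p.Prime], p ≠ 2 → Literature.NumberTheory.EllipticCurves.IsOrdinaryAt W p → ∀ {N : ℕ} [NeZero N] (f : CuspForm (CongruenceSubgroup.Gamma0 N) 2), Literature.NumberTheory.EllipticCurves.ModularForms.IsNewformOf W f → (W.mor

/-- item stmt-BirchSwinnertonDyer-0491 · support · rank 5 · open · by planner
SUPERSEDES stmt-BirchSwinnertonDyer-0139 (r2). The old item was FALSELY closed 2026-08-13T06:58:11Z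
by the gate decides-probe of p2749 as 'proved' by
Literature.EllArith.HigherGrossZagierDatum.leadingLCoeff_eq / det_ne_zero_of_leadingLCoeff_ne_zero —
lemmas taking (D : HigherGrossZagierDatum W W.analyticRank) as hypothesis, which cannot inhabit this
Prop (the same probe 'proved' both old 0145 and its negation-side 0257). Statement, rank and route
unchanged; grounder/refuter notes on stmt-BirchSwinnertonDyer-0139 remain valid and should be
copied, not redone. Near-Literature inequality validating all normalisations: rank ≤ corank
Sel_{p^∞} (Kummer) ≤ ord_T char_Λ X(E/ℚ_∞) (Mazur control, Greenberg1999 §4) ≤ ord_T L_p (Kato2004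
Thm 17.4 divisibility in Λ⊗ℚ_p = Literature.NumberTheory.EllipticCurves.kato_divisibility). Rubin,
Euler Systems, needs p ≠ 2. imports: Summits.BirchSwinnertonDyer.Statement,
Literature.NumberTheory.EllipticCurves.PAdicBSD (routes/SketchPAdic.lean). NOT elaborated at filing
time: DiophantineGeometry/Conductor.olean missing from the shared build (import fails before the
term is read); every constant checked against source. Refuter: re-check after rebuild. -/
@[route_item "route-BirchSwinnertonDyer-PAdicOrder"]
def PAdicOrderKatoSideR2 : Prop :=
  ∀ (W : WeierstrassCurve ℚ) [W.IsElliptic] [W.IsGloballyMinimal] (p : ℕ) [Fact p.Prime], p ≠ 2 → Literature.NumberTheory.EllipticCurves.IsOrdinaryAt W p → ∀ {N : ℕ} [NeZero N] (f : CuspForm (CongruenceSubgroup.Gamma0 N) 2), Literature.NumberTheory.EllipticCurves.ModularForms.IsNewformOf W f → (W.mordellWeilRank : ℕ∞) ≤ (Literature.NumberTheory.EllipticCurves.padicLFunction f (Literature.NumberTheory.EllipticCurves.unitRoot W p : ℚ_[p])).order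

/-- item stmt-BirchSwinnertonDyer-0140 · support · rank 6 · closed · proved by Summit.BirchSwinnertonDyer.BirchSwinnertonDyer.Theorems.padicOrderExistsOrdinary_proof (prover) · by planner
Existence of a good ordinary prime ≥ 5 (Literature.NumberTheory.EllipticCurves.IsOrdinaryAt unfolded
so it elaborates against part-A imports). Theorem: supersingular primes have density 0 for non-CM E
(Serre1981 §8, via Chebotarev + Hasse: p ≥ 5 supersingular ⇔ a_p = 0) and density 1/2 for CM E
(Deuring); Elkies1987 for context. imports: Summits.BirchSwinnertonDyer.Statement,
Literature.NumberTheory.EllipticCurves.{Selmer,Sha,Heights,GaloisAction,Tamagawa,BSDInvariants}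
(routes/Sketch.lean, lean check rc 0 on 2026-08-13). -/
@[route_item "route-BirchSwinnertonDyer-PAdicOrder"]
def PAdicOrderExistsOrdinary : Prop :=
  ∀ (W : WeierstrassCurve ℚ) [W.IsElliptic] [W.IsGloballyMinimal], ∃ (p : ℕ) (_ : Fact p.Prime), 5 ≤ p ∧ W.HasGoodReductionAtPrime p ∧ ¬ (p : ℤ) ∣ W.frobeniusTrace p

/-- item stmt-BirchSwinnertonDyer-0525 · support · rank 7 · closed · moot by None · by planner
r6 (session 68): ANALYTIC-RANK-0 CASE of crux #4 (stmt-BirchSwinnertonDyer-0509, height-free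
Schneider = T-semisimplicity of X(E/ℚ_∞)⊗ℚ_p at T=0), filed on grounder-ground-A-0's recommendation
(note on 0509, 2026-08-13T07:16Z: 'for r_an = 0 the item follows from facts in tree — a provable
SPECIAL CASE worth a separate item'). STATEMENT (stronger than the literal specialisation): E/ℚ
elliptic (globally minimal W), p odd good ordinary, ℚ_∞/ℚ cyclotomic with topological generator γ
matching the cyclotomic variable of L_p
(Literature.NumberTheory.EllipticCurves.IsCyclotomicVariable, PAdicBSD.lean:214 — the extra premise
Kato's theorem carries), X = D.X the Pontryagin dual of Sel_{p^∞}(E/ℚ_∞) (any D : SelmerDualData, T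
= γ−1 = PowerSeries.X): if ord_{s=1} L(E,s) = 0 then X ⊗ ℚ_p has NO T-torsion, spelled ⊗-free:
p^k·T·x = 0 for some k ⇒ p^k'·x = 0 for some k'. IMPLIES 0509 at r_an = 0 (apply to T·x). PROOF
SKETCH FROM VENDORED RESULTS (why 'cheap'): (1) r_an = 0 ⇔ L(E,1) ≠ 0 (analyticRank = order of
vanishing of W.entireLFunction at 1; AnalyticRank.lean); (2) interpolation
mazur_swinnertonDyer_interpolation (PAdicBSD.lean:236): L_p(E,0) = (1−α⁻¹)²·L(E,1)/Ω⁺ with α =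
unitRoot W p; α ≠ 1 -/
@[route_item "route-BirchSwinnertonDyer-PAdicOrder"]
def PAdicOrderRankZeroNoTtorsionR6 : Prop :=
  ∀ (W : WeierstrassCurve ℚ) [W.IsElliptic] [W.IsGloballyMinimal] (p : ℕ) [Fact p.Prime], p ≠ 2 → Literature.NumberTheory.EllipticCurves.IsOrdinaryAt W p → W.analyticRank = 0 → ∀ (κ : Literature.NumberTheory.EllipticCurves.ZpExtension ℚ p) (γ : Field.absoluteGaloisGroup ℚ), κ.IsCyclotomic → κ.IsTopGenerator γ → ∀ (D : W.SelmerDualData κ γ) (x : D.X), (∃ k : ℕ, (PowerSeries.C ((p : ℤ_[p]) ^ k) * PowerSeries.X : Literature.NumberTheory.EllipticCurves.IwasawaAlgebra p) • x = 0) → ∃ k : ℕ, (PowerSeries.C ((p : ℤ_[p]) ^ k) : Literature.NumberTheory.EllipticCurves.IwasawaAlgebra p) • x = 0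

/-- item stmt-BirchSwinnertonDyer-1058 · support · rank 9 · closed · moot by None · by planner
[support] GLUE cruxes → thesis X, filed by the cone-repair planner (rrepair, 2026-08-15) to NAME the
one load-bearing undischarged fact of this route. needs-fact:
Literature.NumberTheory.EllipticCurves.ModularForms.exists_isNewformOf (modularity, BCDT 2001 Thm A
/ DiamondShurman2005 Thm 8.8.3 — the Mazur–Swinnerton-Dyer p-adic L-function padicLFunction f
(unitRoot W p) is the one OF THE NEWFORM f, so the target's ∃ N f cannot be discharged otherwise; no
restatement avoids it). Derived, not separately needed: WeierstrassCurve.hasEntireLFunction_rat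
(Statement cone; = hasEntireLFunction_rat_of_exists_isNewformOf, proved) and
ModularForms.existsUnique_isNewformOf (⇔ exists_isNewformOf by existsUnique_isNewformOf_iff,
proved). STATEMENT: exists_isNewformOf → crux #2 PAdicOrderComparisonR2 → crux #3
PAdicOrderPadicBSDrankR2 → target PAdicOrderThesisR2. CLOSABLE TODAY (6 lines, elaborated rc 0 in
the planner folder SketchGlueProof2.lean, theorem cruxesToThesis): for W elliptic and globally
minimal take p ≥ 5 good ordinary from the tree theorem
WeierstrassCurve.exists_good_ordinary_prime_holds (IsOrdinaryAt W p is ⟨hgood, hord⟩ by Iff.rfl),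
the instance NeZero (W.conductorNorm ℤ) from Wei -/
@[route_item "route-BirchSwinnertonDyer-PAdicOrder"]
def CruxesToThesis : Prop :=
  (∀ (W : WeierstrassCurve ℚ) [W.IsElliptic] [NeZero (W.conductorNorm ℤ)], ∃ f : CuspForm (CongruenceSubgroup.Gamma0 (W.conductorNorm ℤ)) 2, Literature.NumberTheory.EllipticCurves.ModularForms.IsNewformOf W f) → Summit.BirchSwinnertonDyer.BirchSwinnertonDyer.Theses.PAdicOrder.PAdicOrderComparisonR2 → Summit.BirchSwinnertonDyer.BirchSwinnertonDyer.Theses.PAdicOrder.PAdicOrderPadicBSDrankR2 → Summit.BirchSwinnertonDyer.BirchSwinnertonDyer.Theses.PAdicOrder.PAdicOrderThesisR2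

/-- item stmt-BirchSwinnertonDyer-0135 · assembly · rank 1 · closed · moot by None · by planner
Assembly: pass to a globally minimal model (fact hasGlobalMinimalModel_rat, Neron1964 / Silverman
AEC VIII.8.3), use invariance of both ranks under VariableChange (facts
mordellWeilRank_variableChange, analyticRank_variableChange in BSDInvariants), then transitivity
through ord_T L_p in ℕ∞ (Nat.cast injective). imports: Summits.BirchSwinnertonDyer.Statement,
Literature.NumberTheory.EllipticCurves.PAdicBSD (routes/SketchPAdic.lean). NOT elaborated at filing
time: DiophantineGeometry/Conductor.olean missing from the shared build (import fails before the
term is read); every constant checked against source. Refuter: re-check after rebuild. -/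
@[route_item "route-BirchSwinnertonDyer-PAdicOrder"]
def Assembly : Prop :=
  WeierstrassCurve.hasGlobalMinimalModel_rat → (∀ (W : WeierstrassCurve ℚ) (C : WeierstrassCurve.VariableChange ℚ), W.mordellWeilRank_variableChange C ∧ W.analyticRank_variableChange C) → (∀ (W : WeierstrassCurve ℚ) [W.IsElliptic] [W.IsGloballyMinimal], ∃ (p : ℕ) (_ : Fact p.Prime), Literature.NumberTheory.EllipticCurves.IsOrdinaryAt W p ∧ ∃ (N : ℕ) (_ : NeZero N) (f : CuspForm (CongruenceSubgroup.Gamma0 N) 2), Literature.NumberTheory.EllipticCurves.ModularForms.IsNewformOf W f ∧ (Literature.NumberTheory.EllipticCurves.padicLFunction f (Literature.NumberTheory.EllipticCurves.unitRoot W p : ℚ_[p])).order = W.analyticRank ∧ (Literature.NumberTheory.EllipticCurves.padicLFunction f (Literature.NumberTheory.EllipticCurves.unitRoot W p : ℚ_[p])).order = W.mordellWeilRank) → BirchSwinnertonDyer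

/-- item stmt-BirchSwinnertonDyer-0488 · assembly · rank 1 · closed · moot by None · by planner
SUPERSEDES stmt-BirchSwinnertonDyer-0135 (r2). The old item was FALSELY closed 2026-08-13T06:58:11Z
by the gate decides-probe of p2749 as 'proved' by
Literature.EllArith.HigherGrossZagierDatum.leadingLCoeff_eq / det_ne_zero_of_leadingLCoeff_ne_zero —
lemmas taking (D : HigherGrossZagierDatum W W.analyticRank) as hypothesis, which cannot inhabit this
Prop (the same probe 'proved' both old 0145 and its negation-side 0257). Statement, rank and route
unchanged; grounder/refuter notes on stmt-BirchSwinnertonDyer-0135 remain valid and should be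
copied, not redone. Assembly: pass to a globally minimal model (fact hasGlobalMinimalModel_rat,
Neron1964 / Silverman AEC VIII.8.3), use invariance of both ranks under VariableChange (facts
mordellWeilRank_variableChange, analyticRank_variableChange in BSDInvariants), then transitivity
through ord_T L_p in ℕ∞ (Nat.cast injective). imports: Summits.BirchSwinnertonDyer.Statement,
Literature.NumberTheory.EllipticCurves.PAdicBSD (routes/SketchPAdic.lean). NOT elaborated at filing
time: DiophantineGeometry/Conductor.olean missing from the shared build (import fails before the
term is read); every constant checked against source. Refuter: re-check after -/
@[route_item "route-BirchSwinnertonDyer-PAdicOrder"]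
def Assembly2 : Prop :=
  WeierstrassCurve.hasGlobalMinimalModel_rat → (∀ (W : WeierstrassCurve ℚ) (C : WeierstrassCurve.VariableChange ℚ), W.mordellWeilRank_variableChange C ∧ W.analyticRank_variableChange C) → (∀ (W : WeierstrassCurve ℚ) [W.IsElliptic] [W.IsGloballyMinimal], ∃ (p : ℕ) (_ : Fact p.Prime), Literature.NumberTheory.EllipticCurves.IsOrdinaryAt W p ∧ ∃ (N : ℕ) (_ : NeZero N) (f : CuspForm (CongruenceSubgroup.Gamma0 N) 2), Literature.NumberTheory.EllipticCurves.ModularForms.IsNewformOf W f ∧ (Literature.NumberTheory.EllipticCurves.padicLFunction f (Literature.NumberTheory.EllipticCurves.unitRoot W p : ℚ_[p])).order = W.analyticRank ∧ (Literature.NumberTheory.EllipticCurves.padicLFunction f (Literature.NumberTheory.EllipticCurves.unitRoot W p : ℚ_[p])).order = W.mordellWeilRank) → BirchSwinnertonDyer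

end Summit.BirchSwinnertonDyer.BirchSwinnertonDyer.Theses.PAdicOrder
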